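import Literature.Analysis.FluidPDE.HardSphereFlowRestart
import Literature.Analysis.FluidPDE.HardSphereTorusMeasure
import HarnessLib

/-!
# The hard-sphere flow on the torus over a short time window

Sixth layer of the proof of Alexander's theorem on `T^d`
(`Kinetic.HardSphereFlow.nonempty_torus`): the deterministic analysis of the
collision-by-collision flow `Φ_t = Kinetic.Alexander.fwdFlow` over a window `[0, δ]` on which at
most one pair of particles can interact — the engine of Gallagher–Saint-Raymond–Texier 2013,
proof of Prop. 4.1.1 ("we only study what happens for `t ∈ [0, δ]` … then iterate"). Fix the
diameter `0 < ε`, a speed bound `V` (all speeds `≤ V`, e.g. on the energy shell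
`E(z) ≤ V²/2`), a window `δ` and an interaction length `r ≥ 2Vδ` with `ε + 2r < 1/2` (so that
an interacting pair stays inside one chart of the torus).

* Displacements: under free flight a minimal-image distance changes by at most
  `|t| (‖v_k‖ + ‖v_l‖)` (`norm_sepVec_freeFlight_ge`); a pair at distance `> ε + r` (*far*) stays
  at distance `> ε` during the window (`lt_norm_sepVec_freeFlight_of_far`); a pair at distance
  `≤ ε + r` evolves in the chart, `sep(S_t z) = q + t w` (`sepVec_freeFlight_eq`).
* The pieces of the short-time good set `shortGood` (GST 2013 p. 19, the two "possibilities"):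
  `farSet` (all pairs far), `noHitPiece i j` (only the pair `(i, j)` is close, and its free
  relative motion does not reach distance `ε` within time `δ`), `hitPiece i j` (only `(i, j)` is
  close and it hits non-grazingly at a time `τ₀ ≤ δ`, i.e. its relative data lie in
  `Kinetic.billiardGood`).
* **No collision** (`farSet`, `noHitPiece`): `τ(z) > δ`, forward regularity up to `δ`
  (`FwdGoodUpTo`), and `Φ_t z = S_t z` on `[0, δ]` (`fwdGoodUpTo_of_forall_lt_norm` and
  corollaries).
* **One collision** (`hitPiece`): `τ(z) = τ₀`, the exit configuration is simple incoming with
  colliding pair `(i, j)`, the post-collisional state `z₁` does not collide again before `δ`,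
  `FwdGoodUpTo G ε δ z`, and `Φ_δ z = S_{δ-τ₀} z₁ = S_δ (pairCollide ε i j z)` where
  `pairCollide` is the two-body collision map of `HardSphereBilliard` (`twoBodyCollide`) written
  on the torus (`fwdFlow_eq_freeFlight_pairCollide`).
* The one-step map `kick` (`= pairCollide` on the hit pieces, the identity elsewhere), with
  `Φ_δ = S_δ ∘ kick` on `shortGood` (`fwdFlow_eq_freeFlight_kick`) and **`kick` is injective on
  `shortGood`** (`kick_injOn`: two hard spheres that have just collided separate, so the first
  contact time read backwards identifies the piece).
* **What is not short-time good is thin**: a configuration of the domain outside `shortGood`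
  has a pair in contact, or two distinct close pairs, or a grazing pair
  (`mem_shortBad_of_not_mem_shortGood`), whence, by the toolkit of `HardSphereTorusMeasure`,
  `vol((D \ shortGood) ∩ velBall V) ≤ N⁴ (d r vol B₁)² vol(B̄_V)^N`
  (`volume_diff_shortGood_inter_velBall_le`, GST 2013 Lemma 4.1.2).

## Mathlib / Literature reuse

Pair kinematics (`PairHits`, `pairHitTime`, `hitPoint`, `hitVel`, `billiardGood`, first-contact
and no-recollision lemmas) are `HardSphereBilliard`'s; the chart and displacement lemmas, energy
bounds, `velBall`, `closePair` and the null/thin-set estimates are `HardSphereTorusMeasure`'s;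
exit times, `IsSimpleIncomingWith`, `collisionStep_eq_collidePair`, `fwdFlow_eq_of_segment` are
`HardSphereFlowOrbits`'; `FwdGoodUpTo` is `HardSphereFlowRestart`'s. Mathlib has no billiard
flow.

## Design choices

* The pieces are defined by closed-form (in)equalities on the datum (distances, the
  discriminant and the hitting time of one pair), not dynamically, so that their measures can
  be estimated and their measurability is evident; the dynamical consequences are theorems.
* Contact at time `0` (`‖q‖ = ε`) is excluded from all pieces (it is a null event), which makes
  `τ₀ > 0` on the hit pieces and all inequalities strict.
* Speeds are controlled through the hypothesis `∀ i, ‖v_i‖ ≤ V` for the no-collision pieces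
  and through the energy shell `E(z) ≤ V²/2` (invariant under collisions) for the hit pieces.

## References

* I. Gallagher, L. Saint-Raymond, B. Texier, *From Newton to Boltzmann: hard spheres and
  short-range potentials*, EMS (2013), arXiv:1208.5753, §4.1, proof of Prop. 4.1.1 and
  Lemma 4.1.2 (p. 19).
* C. Cercignani, R. Illner, M. Pulvirenti, *The Mathematical Theory of Dilute Gases*, Springer
  (1994), §4.2, App. 4.A.
-/

open Set Filter Topology Function MeasureTheory Metric
open scoped ENNReal InnerProductSpace

namespace Literature.Analysis.FluidPDE

noncomputable section

section Kinetic

namespace Alexander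

variable {d : Type*} [Fintype d] {N : ℕ}

/-! ## Displacements and charts along free flight on the torus -/

/-- Under free flight the minimal-image distance of two particles decreases by at most
`|t| (‖v_k‖ + ‖v_l‖)`. [folklore] -/
theorem norm_sepVec_freeFlight_ge (z : Config N d (UnitAddTorus d)) (t : ℝ) (k l : Fin N) :
    ‖(Torus.geometry d).sepVec (z k).1 (z l).1‖ - |t| * (‖(z k).2‖ + ‖(z l).2‖) ≤
      ‖(Torus.geometry d).sepVec (freeFlight (Torus.geometry d) t z k).1
        (freeFlight (Torus.geometry d) t z l).1‖ := by
  simp only [freeFlight_apply, Torus.geometry_translate, Torus.norm_geometry_sepVec]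
  have h := Torus.euclidDist_le_euclidDist_translate (z k).1 (z l).1 (t • (z k).2) (t • (z l).2)
  have h2 : ‖t • (z k).2 - t • (z l).2‖ ≤ |t| * (‖(z k).2‖ + ‖(z l).2‖) := by
    rw [← smul_sub, norm_smul, Real.norm_eq_abs]
    exact mul_le_mul_of_nonneg_left (norm_sub_le _ _) (abs_nonneg t)
  linarith

/-- **A far pair stays out of contact during the window**: if all speeds are `≤ V`,
`2Vδ ≤ r` and `‖x_k - x_l‖ > ε + r`, then `‖x_k(t) - x_l(t)‖ > ε` for `|t| ≤ δ`. [folklore] -/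
theorem lt_norm_sepVec_freeFlight_of_far {z : Config N d (UnitAddTorus d)} {V r δ ε t : ℝ}
    (hV : ∀ i, ‖(z i).2‖ ≤ V) (hr : 2 * V * δ ≤ r) {k l : Fin N}
    (hfar : ε + r < ‖(Torus.geometry d).sepVec (z k).1 (z l).1‖) (ht : |t| ≤ δ) :
    ε < ‖(Torus.geometry d).sepVec (freeFlight (Torus.geometry d) t z k).1
        (freeFlight (Torus.geometry d) t z l).1‖ := by
  have h := norm_sepVec_freeFlight_ge z t k l
  have hV0 : 0 ≤ V := (norm_nonneg _).trans (hV k)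
  have h1 : |t| * (‖(z k).2‖ + ‖(z l).2‖) ≤ δ * (V + V) :=
    mul_le_mul ht (add_le_add (hV k) (hV l)) (by positivity) ((abs_nonneg t).trans ht)
  nlinarith

/-- The same with two successive free flights and changed velocities in between (as after a
collision): if all speeds of `z` and of `z'` are `≤ V`, `z'` has the positions of `S_s z`,
`2Vδ ≤ r`, `0 ≤ s`, `s + |t| ≤ δ` and the pair is far in `z`, then it is out of contact in
`S_t z'`. [folklore] -/
theorem lt_norm_sepVec_freeFlight_of_far₂ {z z' : Config N d (UnitAddTorus d)}
    {V r δ ε s t : ℝ} (hV : ∀ i, ‖(z i).2‖ ≤ V) (hV' : ∀ i, ‖(z' i).2‖ ≤ V)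
    (hpos : ∀ i, (z' i).1 = (freeFlight (Torus.geometry d) s z i).1) (hr : 2 * V * δ ≤ r)
    (hs : 0 ≤ s) (hst : s + |t| ≤ δ) {k l : Fin N}
    (hfar : ε + r < ‖(Torus.geometry d).sepVec (z k).1 (z l).1‖) :
    ε < ‖(Torus.geometry d).sepVec (freeFlight (Torus.geometry d) t z' k).1
        (freeFlight (Torus.geometry d) t z' l).1‖ := by
  have h1 := norm_sepVec_freeFlight_ge z s k l
  have h2 := norm_sepVec_freeFlight_ge z' t k l
  rw [hpos k, hpos l] at h2
  have hV0 : 0 ≤ V := (norm_nonneg _).trans (hV k)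
  have h3 : |s| * (‖(z k).2‖ + ‖(z l).2‖) ≤ s * (V + V) := by
    rw [abs_of_nonneg hs]
    exact mul_le_mul_of_nonneg_left (add_le_add (hV k) (hV l)) hs
  have h4 : |t| * (‖(z' k).2‖ + ‖(z' l).2‖) ≤ |t| * (V + V) :=
    mul_le_mul_of_nonneg_left (add_le_add (hV' k) (hV' l)) (abs_nonneg t)
  nlinarith [abs_nonneg t]

/-- **The chart of a pair along free flight**: as long as `‖q‖ + |t| ‖w‖ < 1/2`
(`q = x_i - x_j` the minimal image, `w = v_i - v_j`), the separation vector of the pair in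
`S_t z` is `q + t w`. [folklore] -/
theorem sepVec_freeFlight_eq {z : Config N d (UnitAddTorus d)} {t : ℝ} {i j : Fin N}
    (h : ‖(Torus.geometry d).sepVec (z i).1 (z j).1‖ + |t| * ‖(z i).2 - (z j).2‖ < 1 / 2) :
    (Torus.geometry d).sepVec (freeFlight (Torus.geometry d) t z i).1
        (freeFlight (Torus.geometry d) t z j).1 =
      (Torus.geometry d).sepVec (z i).1 (z j).1 + t • ((z i).2 - (z j).2) := by
  simp only [freeFlight_apply]
  have h' : ‖(Torus.geometry d).sepVec (z i).1 (z j).1‖ + ‖t • (z i).2 - t • (z j).2‖ < 1 / 2 := by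
    rwa [← smul_sub, norm_smul, Real.norm_eq_abs]
  rw [Torus.sepVec_translate_of_norm_lt h', smul_sub]

/-- The minimal-image distance is symmetric in the pair. [folklore] -/
theorem norm_sepVec_comm (x y : UnitAddTorus d) :
    ‖(Torus.geometry d).sepVec x y‖ = ‖(Torus.geometry d).sepVec y x‖ := by
  rw [Torus.norm_geometry_sepVec, Torus.norm_geometry_sepVec, Torus.euclidDist_comm]

/-- The relative speed of a pair is at most twice the speed bound. [folklore] -/
theorem norm_vel_sub_le {z : Config N d (UnitAddTorus d)} {V : ℝ} (hV : ∀ i, ‖(z i).2‖ ≤ V)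
    (i j : Fin N) : ‖(z i).2 - (z j).2‖ ≤ 2 * V :=
  (norm_sub_le _ _).trans (by linarith [hV i, hV j])

/-! ## The pieces of the short-time good set -/

variable (N) in
/-- All pairs are *far*: at minimal-image distance `> ε + r` (no interaction is possible
during the window; the first possibility of GST 2013 p. 19). [cite: GST2013, proof of Prop. 4.1.1 p. 19] -/
def farSet (ε r : ℝ) : Set (Config N d (UnitAddTorus d)) :=
  {z | ∀ k l : Fin N, k ≠ l → ε + r < ‖(Torus.geometry d).sepVec (z k).1 (z l).1‖}

/-- All pairs other than `{i, j}` are far. [folklore] -/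
def OthersFar (ε r : ℝ) (z : Config N d (UnitAddTorus d)) (i j : Fin N) : Prop :=
  ∀ k l : Fin N, k ≠ l → ({k, l} : Finset (Fin N)) ≠ {i, j} →
    ε + r < ‖(Torus.geometry d).sepVec (z k).1 (z l).1‖

variable (N) in
/-- The *no-hit piece* of the pair `(i, j)`: only `(i, j)` is close (`ε < ‖q‖ ≤ ε + r`, no
contact at time `0`), and its free relative motion `q + t w` does not reach distance `ε`
within time `δ` (it never does, or does so only after `δ`). [cite: GST2013, proof of Prop. 4.1.1 p. 19] -/
def noHitPiece (ε r δ : ℝ) (i j : Fin N) : Set (Config N d (UnitAddTorus d)) :=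
  {z | OthersFar ε r z i j ∧ ε < ‖(Torus.geometry d).sepVec (z i).1 (z j).1‖ ∧
    ‖(Torus.geometry d).sepVec (z i).1 (z j).1‖ ≤ ε + r ∧
    (¬ PairHits ε ((Torus.geometry d).sepVec (z i).1 (z j).1) ((z i).2 - (z j).2) ∨
      δ < pairHitTime ε ((Torus.geometry d).sepVec (z i).1 (z j).1) ((z i).2 - (z j).2))}

variable (N) in
/-- The *hit piece* of the pair `(i, j)`: only `(i, j)` is close, and its free relative motion
hits the contact sphere non-grazingly (`billiardGood`: `ε < ‖q‖`, `⟪q, w⟫ < 0`, positive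
discriminant) at a time `τ₀ ≤ δ` (the second possibility of GST 2013 p. 19, minus the grazing
set). [cite: GST2013, proof of Prop. 4.1.1 p. 19] -/
def hitPiece (ε r δ : ℝ) (i j : Fin N) : Set (Config N d (UnitAddTorus d)) :=
  {z | OthersFar ε r z i j ∧ ‖(Torus.geometry d).sepVec (z i).1 (z j).1‖ ≤ ε + r ∧
    ((Torus.geometry d).sepVec (z i).1 (z j).1, (z i).2 - (z j).2) ∈
      (billiardGood ε : Set (EuclideanSpace ℝ d × EuclideanSpace ℝ d)) ∧
    pairHitTime ε ((Torus.geometry d).sepVec (z i).1 (z j).1) ((z i).2 - (z j).2) ≤ δ}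

variable (N) in
/-- The **short-time good set** `shortGood ε r δ`: all pairs far, or exactly one close pair
`i < j` which either does not hit within `δ` or hits non-grazingly within `δ` (GST 2013 p. 19:
outside a small-measure set these are the only possibilities). [cite: GST2013, proof of Prop. 4.1.1 p. 19] -/
def shortGood (ε r δ : ℝ) : Set (Config N d (UnitAddTorus d)) :=
  farSet N ε r ∪ ⋃ (p : Fin N × Fin N) (_ : p.1 < p.2),
    (noHitPiece N ε r δ p.1 p.2 ∪ hitPiece N ε r δ p.1 p.2)

/-- Membership in `shortGood`. [folklore] -/
theorem mem_shortGood {ε r δ : ℝ} {z : Config N d (UnitAddTorus d)} :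
    z ∈ shortGood N ε r δ ↔ z ∈ farSet N ε r ∨
      ∃ p : Fin N × Fin N, p.1 < p.2 ∧ (z ∈ noHitPiece N ε r δ p.1 p.2 ∨ z ∈ hitPiece N ε r δ p.1 p.2) := by
  simp only [shortGood, mem_union, mem_iUnion, exists_prop]

/-- On a far configuration every pair is out of contact, with room `r`. [folklore] -/
theorem farSet_subset_hardSphereDomain {ε r : ℝ} (hr : 0 ≤ r) :
    farSet N ε r ⊆ hardSphereDomain (Torus.geometry d) N ε :=
  fun _ hz k l hkl => by linarith [hz k l hkl]

/-- In a configuration whose pairs other than `{i, j}` are far and whose pair `(i, j)` is at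
distance `> ε`, resp. `≥ ε`, every pair is at distance `> ε`, resp. the configuration is in
the domain. [folklore] -/
theorem lt_norm_sepVec_of_othersFar {ε r : ℝ} (hr : 0 ≤ r) {z : Config N d (UnitAddTorus d)}
    {i j : Fin N} (ho : OthersFar ε r z i j)
    (hq : ε < ‖(Torus.geometry d).sepVec (z i).1 (z j).1‖) {k l : Fin N} (hkl : k ≠ l) :
    ε < ‖(Torus.geometry d).sepVec (z k).1 (z l).1‖ := by
  by_cases h : ({k, l} : Finset (Fin N)) = {i, j}
  · rcases finsetPair_eq_iff.1 h with ⟨rfl, rfl⟩ | ⟨rfl, rfl⟩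
    · exact hq
    · rwa [norm_sepVec_comm]
  · linarith [ho k l hkl h]

/-- A configuration whose pairs other than `{i, j}` are far (`r ≥ 0`) and whose pair `(i, j)`
is at distance `≥ ε` lies in the hard-sphere domain. [folklore] -/
theorem mem_hardSphereDomain_of_othersFar {ε r : ℝ} (hr : 0 ≤ r)
    {z : Config N d (UnitAddTorus d)} {i j : Fin N} (ho : OthersFar ε r z i j)
    (hq : ε ≤ ‖(Torus.geometry d).sepVec (z i).1 (z j).1‖) :
    z ∈ hardSphereDomain (Torus.geometry d) N ε := by
  intro k l hkl
  by_cases h : ({k, l} : Finset (Fin N)) = {i, j}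
  · rcases finsetPair_eq_iff.1 h with ⟨rfl, rfl⟩ | ⟨rfl, rfl⟩
    · exact hq
    · rwa [norm_sepVec_comm]
  · exact (le_add_of_nonneg_right hr).trans (ho k l hkl h).le

/-- The no-hit piece lies in the domain. [folklore] -/
theorem noHitPiece_subset_hardSphereDomain {ε r δ : ℝ} (hr : 0 ≤ r) (i j : Fin N) :
    noHitPiece N ε r δ i j ⊆ hardSphereDomain (Torus.geometry d) N ε :=
  fun _ hz => mem_hardSphereDomain_of_othersFar hr hz.1 hz.2.1.le

/-- The hit piece lies in the domain. [folklore] -/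
theorem hitPiece_subset_hardSphereDomain {ε r δ : ℝ} (hr : 0 ≤ r) (i j : Fin N) :
    hitPiece N ε r δ i j ⊆ hardSphereDomain (Torus.geometry d) N ε :=
  fun _ hz => mem_hardSphereDomain_of_othersFar hr hz.1 hz.2.2.1.1.le

/-- The short-time good set lies in the domain. [folklore] -/
theorem shortGood_subset_hardSphereDomain {ε r δ : ℝ} (hr : 0 ≤ r) :
    shortGood N ε r δ ⊆ hardSphereDomain (Torus.geometry d) N ε := by
  intro z hz
  rcases mem_shortGood.1 hz with h | ⟨p, -, h | h⟩
  · exact farSet_subset_hardSphereDomain hr h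
  · exact noHitPiece_subset_hardSphereDomain hr _ _ h
  · exact hitPiece_subset_hardSphereDomain hr _ _ h

/-! ## No collision during the window -/

section NoCollision

variable {ε δ : ℝ} {z : Config N d (UnitAddTorus d)}

/-- **No contact during the window means no collision**: if every pair of `S_t z` is at
distance `> ε` for all `t ∈ [0, δ]` then `τ(z) > δ` (the exit configuration of a regular
geometry has a contact pair). [folklore] -/
theorem ofReal_lt_freeExitTime_of_forall_lt_norm (hε' : ε < 2⁻¹) (hδ : 0 ≤ δ)
    (H : ∀ t ∈ Icc (0 : ℝ) δ, ∀ k l : Fin N, k ≠ l →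
      ε < ‖(Torus.geometry d).sepVec (freeFlight (Torus.geometry d) t z k).1
        (freeFlight (Torus.geometry d) t z l).1‖) :
    ENNReal.ofReal δ < freeExitTime (Torus.geometry d) ε z := by
  have hG := Torus.isHardSphereRegular_geometry (d := d) hε'
  have hz : z ∈ hardSphereDomain (Torus.geometry d) N ε := fun k l hkl => by
    simpa using (H 0 ⟨le_rfl, hδ⟩ k l hkl).le
  by_contra hle
  rw [not_lt] at hle
  have hfin : freeExitTime (Torus.geometry d) ε z ≠ ∞ := ne_top_of_le_ne_top ENNReal.ofReal_ne_top hle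
  obtain ⟨k, l, hkl, hc, -⟩ := exists_isIncoming_freeFlight_freeExitTime hG hz hfin
  have ht : (freeExitTime (Torus.geometry d) ε z).toReal ∈ Icc (0 : ℝ) δ :=
    ⟨ENNReal.toReal_nonneg, ENNReal.toReal_le_of_le_ofReal hδ hle⟩
  exact (H _ ht k l hkl).ne' hc.2

/-- **No contact during the window gives forward regularity up to `δ`.** [folklore] -/
theorem fwdGoodUpTo_of_forall_lt_norm (hε' : ε < 2⁻¹) (hδ : 0 ≤ δ)
    (H : ∀ t ∈ Icc (0 : ℝ) δ, ∀ k l : Fin N, k ≠ l →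
      ε < ‖(Torus.geometry d).sepVec (freeFlight (Torus.geometry d) t z k).1
        (freeFlight (Torus.geometry d) t z l).1‖) :
    FwdGoodUpTo (Torus.geometry d) ε δ z := by
  have hτ := ofReal_lt_freeExitTime_of_forall_lt_norm hε' hδ H
  have h1 : ∀ k, ¬ collisionInstant (Torus.geometry d) ε z (k + 1) ≤ ENNReal.ofReal δ := by
    intro k hk
    have hmono : collisionInstant (Torus.geometry d) ε z 1 ≤
        collisionInstant (Torus.geometry d) ε z (k + 1) := monotone_collisionInstant z (by omega)
    rw [collisionInstant_one] at hmono
    exact (not_le.2 hτ) (hmono.trans hk)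
  refine ⟨fun k hk => (h1 k hk).elim, fun k t ht htk hkt i j hij => ?_, ⟨1, by rwa [collisionInstant_one]⟩⟩
  cases k with
  | zero =>
    rw [collisionInstant_zero, zero_add] at hkt
    rw [stateAfter_zero]
    intro hc
    exact (H t ⟨ht.le, (ENNReal.ofReal_le_ofReal_iff hδ).1 hkt⟩ i j hij).ne' hc.2
  | succ k => exact (h1 k ((le_add_right le_rfl).trans hkt)).elim

/-- **No contact during the window: the flow is free flight on `[0, δ]`.** [folklore] -/
theorem fwdFlow_eq_freeFlight_of_forall_lt_norm (hε' : ε < 2⁻¹) (hδ : 0 ≤ δ)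
    (H : ∀ t ∈ Icc (0 : ℝ) δ, ∀ k l : Fin N, k ≠ l →
      ε < ‖(Torus.geometry d).sepVec (freeFlight (Torus.geometry d) t z k).1
        (freeFlight (Torus.geometry d) t z l).1‖) {s : ℝ} (hs : s ∈ Icc (0 : ℝ) δ) :
    fwdFlow (Torus.geometry d) ε z s = freeFlight (Torus.geometry d) s z :=
  fwdFlow_eq_freeFlight_of_lt
    ((ENNReal.ofReal_le_ofReal hs.2).trans_lt (ofReal_lt_freeExitTime_of_forall_lt_norm hε' hδ H))

end NoCollision

/-! ## The far set and the no-hit pieces: no collision -/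

section NoHit

variable {ε r δ V : ℝ} {z : Config N d (UnitAddTorus d)}

/-- On the far set no pair comes within distance `ε` during the window. [folklore] -/
theorem forall_lt_norm_of_mem_farSet (hV : ∀ i, ‖(z i).2‖ ≤ V) (hr : 2 * V * δ ≤ r)
    (hz : z ∈ farSet N ε r) :
    ∀ t ∈ Icc (0 : ℝ) δ, ∀ k l : Fin N, k ≠ l →
      ε < ‖(Torus.geometry d).sepVec (freeFlight (Torus.geometry d) t z k).1
        (freeFlight (Torus.geometry d) t z l).1‖ :=
  fun t ht k l hkl => lt_norm_sepVec_freeFlight_of_far hV hr (hz k l hkl)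
    (by rw [abs_of_nonneg ht.1]; exact ht.2)

/-- The chart hypothesis for a close pair during the window: `‖q‖ + |t| ‖w‖ < 1/2` when
`‖q‖ ≤ ε + r`, `‖w‖ ≤ 2V`, `|t| ≤ δ`, `2Vδ ≤ r`, `ε + 2r < 1/2`. [folklore] -/
theorem chart_bound (hV : ∀ i, ‖(z i).2‖ ≤ V) (hr : 2 * V * δ ≤ r) (hεr : ε + 2 * r < 2⁻¹)
    {i j : Fin N} (hq : ‖(Torus.geometry d).sepVec (z i).1 (z j).1‖ ≤ ε + r) {t : ℝ}
    (ht : |t| ≤ δ) :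
    ‖(Torus.geometry d).sepVec (z i).1 (z j).1‖ + |t| * ‖(z i).2 - (z j).2‖ < 1 / 2 := by
  have hw := norm_vel_sub_le hV i j
  have hV0 : 0 ≤ V := (norm_nonneg _).trans (hV i)
  have h1 : |t| * ‖(z i).2 - (z j).2‖ ≤ δ * (2 * V) :=
    mul_le_mul ht hw (norm_nonneg _) ((abs_nonneg t).trans ht)
  have : (2⁻¹ : ℝ) = 1 / 2 := by norm_num
  nlinarith

/-- On a no-hit piece no pair comes within distance `ε` during the window. [folklore] -/
theorem forall_lt_norm_of_mem_noHitPiece (hε : 0 < ε) (hV : ∀ i, ‖(z i).2‖ ≤ V)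
    (hr : 2 * V * δ ≤ r) (hεr : ε + 2 * r < 2⁻¹) {i j : Fin N}
    (hz : z ∈ noHitPiece N ε r δ i j) :
    ∀ t ∈ Icc (0 : ℝ) δ, ∀ k l : Fin N, k ≠ l →
      ε < ‖(Torus.geometry d).sepVec (freeFlight (Torus.geometry d) t z k).1
        (freeFlight (Torus.geometry d) t z l).1‖ := by
  obtain ⟨ho, hq, hq', hnh⟩ := hz
  intro t ht
  have ht' : |t| ≤ δ := by rw [abs_of_nonneg ht.1]; exact ht.2
  -- the pair `(i, j)` in the chart
  have hij : ε < ‖(Torus.geometry d).sepVec (freeFlight (Torus.geometry d) t z i).1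
      (freeFlight (Torus.geometry d) t z j).1‖ := by
    rw [sepVec_freeFlight_eq (chart_bound hV hr hεr hq' ht')]
    have key : ¬ PairHits ε ((Torus.geometry d).sepVec (z i).1 (z j).1) ((z i).2 - (z j).2) →
        ε < ‖(Torus.geometry d).sepVec (z i).1 (z j).1 + t • ((z i).2 - (z j).2)‖ := by
      intro hP
      rcases ht.1.eq_or_lt with h0 | htpos
      · rw [← h0, zero_smul, add_zero]; exact hq
      · exact lt_norm_add_smul_of_not_pairHits hε.le hq.le hP (Or.inl hq) htpos
    rcases hnh with hnh | hnh
    · exact key hnh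
    · by_cases hP : PairHits ε ((Torus.geometry d).sepVec (z i).1 (z j).1) ((z i).2 - (z j).2)
      · exact lt_norm_add_smul_of_lt_pairHitTime hP (ht.2.trans_lt hnh)
      · exact key hP
  -- the far-set argument for the other pairs, in the freely moved configuration
  refine fun k l hkl => lt_norm_sepVec_of_othersFar (ε := ε) (r := 0) le_rfl
    (z := freeFlight (Torus.geometry d) t z) (i := i) (j := j) (fun k l hkl hne => ?_) hij hkl
  rw [add_zero]
  exact lt_norm_sepVec_freeFlight_of_far hV hr (ho k l hkl hne) ht'

end NoHit

/-! ## The two-body collision map of a pair, on the torus -/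

/-- The impulse `b = (⟪n, w⟫ / ε²) n` exchanged by the pair `(i, j)` in its (first) collision
under free relative motion, `n = q + τ₀ w` the separation vector at contact (`q = x_i - x_j`
minimal image, `w = v_i - v_j`, `τ₀` the hitting time; GST 2013 (1.1.3)). Junk outside the hit
pieces. [cite: GST2013, (1.1.3)] -/
def pairImpulse (ε : ℝ) (z : Config N d (UnitAddTorus d)) (i j : Fin N) : EuclideanSpace ℝ d :=
  (⟪hitPoint ε ((Torus.geometry d).sepVec (z i).1 (z j).1, (z i).2 - (z j).2),
      (z i).2 - (z j).2⟫_ℝ / ε ^ 2) •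
    hitPoint ε ((Torus.geometry d).sepVec (z i).1 (z j).1, (z i).2 - (z j).2)

/-- **The two-body collision map of the pair `(i, j)` on the torus** (`Kinetic.twoBodyCollide`
of `HardSphereBilliard` in torus coordinates, all other particles fixed):
`x_i ↦ x_i + τ₀ b`, `v_i ↦ v_i - b`, `x_j ↦ x_j - τ₀ b`, `v_j ↦ v_j + b` with `b = pairImpulse`
— flow freely to the collision, reflect, flow freely back (`S_{-τ₀} ∘ C_{ij} ∘ S_{τ₀}`), so that
the dynamics over a window `[0, δ] ∋ τ₀` with exactly this collision is `S_δ ∘ pairCollide`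
(CIP 1994 §4.2, App. 4.A). Junk outside the hit pieces. [cite: CIP1994, §4.2 pp. 64–65] -/
def pairCollide (ε : ℝ) (i j : Fin N) (z : Config N d (UnitAddTorus d)) :
    Config N d (UnitAddTorus d) :=
  update (update z i
    ((z i).1 + FunctionSpaces.Torus.proj (pairHitTime ε ((Torus.geometry d).sepVec (z i).1 (z j).1)
        ((z i).2 - (z j).2) • pairImpulse ε z i j), (z i).2 - pairImpulse ε z i j)) j
    ((z j).1 - FunctionSpaces.Torus.proj (pairHitTime ε ((Torus.geometry d).sepVec (z i).1 (z j).1)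
        ((z i).2 - (z j).2) • pairImpulse ε z i j), (z j).2 + pairImpulse ε z i j)

/-- `pairCollide` does not touch the other particles. [folklore] -/
theorem pairCollide_apply_of_ne {ε : ℝ} {i j k : Fin N} (hki : k ≠ i) (hkj : k ≠ j)
    (z : Config N d (UnitAddTorus d)) : pairCollide ε i j z k = z k := by
  simp [pairCollide, update_of_ne hki, update_of_ne hkj]

/-- `pairCollide` on particle `i`. [folklore] -/
theorem pairCollide_apply_left {ε : ℝ} {i j : Fin N} (hij : i ≠ j)
    (z : Config N d (UnitAddTorus d)) :
    pairCollide ε i j z i =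
      ((z i).1 + FunctionSpaces.Torus.proj (pairHitTime ε ((Torus.geometry d).sepVec (z i).1 (z j).1)
        ((z i).2 - (z j).2) • pairImpulse ε z i j), (z i).2 - pairImpulse ε z i j) := by
  simp [pairCollide, update_of_ne hij]

/-- `pairCollide` on particle `j`. [folklore] -/
theorem pairCollide_apply_right {ε : ℝ} {i j : Fin N} (z : Config N d (UnitAddTorus d)) :
    pairCollide ε i j z j =
      ((z j).1 - FunctionSpaces.Torus.proj (pairHitTime ε ((Torus.geometry d).sepVec (z i).1 (z j).1)
        ((z i).2 - (z j).2) • pairImpulse ε z i j), (z j).2 + pairImpulse ε z i j) := by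
  simp [pairCollide]

/-! ## One collision during the window: the hit pieces -/

/-- The standing hypotheses of the one-collision analysis of the pair `(i, j)` over the window
`[0, δ]`: diameter `ε > 0`, chart room `ε + 2r < 1/2`, displacement room `2Vδ ≤ r`, energy
shell `E(z) ≤ V²/2` (`V ≥ 0`), `i < j`, and `z` in the hit piece of `(i, j)`. [folklore] -/
structure HitHyp (ε r δ V : ℝ) (z : Config N d (UnitAddTorus d)) (i j : Fin N) : Prop where
  /-- The diameter is positive. -/
  ε_pos : 0 < ε
  /-- Room for the chart of the interacting pair. -/
  chart : ε + 2 * r < 2⁻¹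
  /-- Displacements during the window are at most `r/2` per particle. -/
  window : 2 * V * δ ≤ r
  /-- The speed bound is nonnegative. -/
  V_nonneg : 0 ≤ V
  /-- The datum lies on the energy shell of the speed bound. -/
  energy : configEnergy z ≤ V ^ 2 / 2
  /-- The pair is ordered. -/
  lt : i < j
  /-- The datum lies in the hit piece of the pair. -/
  mem : z ∈ hitPiece N ε r δ i j

namespace HitHyp

variable {ε r δ V : ℝ} {z : Config N d (UnitAddTorus d)} {i j : Fin N}
  (h : HitHyp ε r δ V z i j)
include h

/-- The particles of the pair are distinct. [folklore] -/
theorem ne : i ≠ j := ne_of_lt h.lt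

/-- The relative data lie in the billiard good set. [folklore] -/
theorem good : ((Torus.geometry d).sepVec (z i).1 (z j).1, (z i).2 - (z j).2) ∈
    (billiardGood ε : Set (EuclideanSpace ℝ d × EuclideanSpace ℝ d)) := h.mem.2.2.1

/-- The pair hits. [folklore] -/
theorem pairHits : PairHits ε ((Torus.geometry d).sepVec (z i).1 (z j).1) ((z i).2 - (z j).2) :=
  PairHits.of_mem_billiardGood h.good

/-- The pair starts strictly outside contact. [folklore] -/
theorem lt_norm : ε < ‖(Torus.geometry d).sepVec (z i).1 (z j).1‖ := h.good.1

/-- The hitting time is positive. [folklore] -/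
theorem hitTime_pos :
    0 < pairHitTime ε ((Torus.geometry d).sepVec (z i).1 (z j).1) ((z i).2 - (z j).2) :=
  pairHitTime_pos h.ε_pos.le h.lt_norm h.pairHits

/-- The hitting time is within the window. [folklore] -/
theorem hitTime_le :
    pairHitTime ε ((Torus.geometry d).sepVec (z i).1 (z j).1) ((z i).2 - (z j).2) ≤ δ :=
  h.mem.2.2.2

/-- The window is positive. [folklore] -/
theorem δ_pos : 0 < δ := h.hitTime_pos.trans_le h.hitTime_le

/-- The interaction length is nonnegative. [folklore] -/
theorem r_nonneg : 0 ≤ r :=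
  le_trans (mul_nonneg (mul_nonneg two_pos.le h.V_nonneg) h.δ_pos.le) h.window

/-- The diameter is below the chart bound. [folklore] -/
theorem ε_lt : ε < 2⁻¹ := by linarith [h.chart, h.r_nonneg]

/-- Speeds of the datum are at most `V`. [folklore] -/
theorem norm_vel_le (k : Fin N) : ‖(z k).2‖ ≤ V := norm_vel_le_of_configEnergy_le h.V_nonneg h.energy k

/-- The other pairs are far. [folklore] -/
theorem othersFar : OthersFar ε r z i j := h.mem.1

/-- The pair is close. [folklore] -/
theorem norm_le : ‖(Torus.geometry d).sepVec (z i).1 (z j).1‖ ≤ ε + r := h.mem.2.1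

/-- The datum lies in the domain. [folklore] -/
theorem mem_hardSphereDomain : z ∈ hardSphereDomain (Torus.geometry d) N ε :=
  hitPiece_subset_hardSphereDomain h.r_nonneg i j h.mem

/-- The separation vector at contact has norm `ε`. [folklore] -/
theorem norm_hitPoint :
    ‖hitPoint ε ((Torus.geometry d).sepVec (z i).1 (z j).1, (z i).2 - (z j).2)‖ = ε :=
  FluidPDE.norm_hitPoint h.ε_pos.le h.good

/-- **Before the collision no pair is in contact**: for `0 ≤ t < τ₀` every pair of `S_t z` is
at distance `> ε`. [folklore] -/
theorem lt_norm_sepVec_freeFlight_of_lt {t : ℝ} (ht0 : 0 ≤ t)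
    (ht : t < pairHitTime ε ((Torus.geometry d).sepVec (z i).1 (z j).1) ((z i).2 - (z j).2))
    {k l : Fin N} (hkl : k ≠ l) :
    ε < ‖(Torus.geometry d).sepVec (freeFlight (Torus.geometry d) t z k).1
        (freeFlight (Torus.geometry d) t z l).1‖ := by
  have ht' : |t| ≤ δ := by rw [abs_of_nonneg ht0]; exact (ht.le.trans h.hitTime_le)
  have hij : ε < ‖(Torus.geometry d).sepVec (freeFlight (Torus.geometry d) t z i).1
      (freeFlight (Torus.geometry d) t z j).1‖ := by
    rw [sepVec_freeFlight_eq (chart_bound h.norm_vel_le h.window h.chart h.norm_le ht')]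
    exact lt_norm_add_smul_of_lt_pairHitTime h.pairHits ht
  refine lt_norm_sepVec_of_othersFar (ε := ε) (r := 0) le_rfl
    (z := freeFlight (Torus.geometry d) t z) (i := i) (j := j) (fun k l hkl hne => ?_) hij hkl
  rw [add_zero]
  exact lt_norm_sepVec_freeFlight_of_far h.norm_vel_le h.window (h.othersFar k l hkl hne) ht'

/-- **The configuration at the hitting time**: the separation vector of the pair is the hit
point `n = q + τ₀ w`. [folklore] -/
theorem sepVec_freeFlight_hitTime :
    (Torus.geometry d).sepVec
        (freeFlight (Torus.geometry d)
          (pairHitTime ε ((Torus.geometry d).sepVec (z i).1 (z j).1) ((z i).2 - (z j).2)) z i).1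
        (freeFlight (Torus.geometry d)
          (pairHitTime ε ((Torus.geometry d).sepVec (z i).1 (z j).1) ((z i).2 - (z j).2)) z j).1 =
      hitPoint ε ((Torus.geometry d).sepVec (z i).1 (z j).1, (z i).2 - (z j).2) := by
  have ht' : |pairHitTime ε ((Torus.geometry d).sepVec (z i).1 (z j).1) ((z i).2 - (z j).2)| ≤ δ := by
    rw [abs_of_nonneg h.hitTime_pos.le]; exact h.hitTime_le
  rw [sepVec_freeFlight_eq (chart_bound h.norm_vel_le h.window h.chart h.norm_le ht')]
  rfl

/-- At the hitting time the other pairs are at distance `> ε`. [folklore] -/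
theorem lt_norm_sepVec_freeFlight_hitTime_of_ne {k l : Fin N} (hkl : k ≠ l)
    (hne : ({k, l} : Finset (Fin N)) ≠ {i, j}) :
    ε < ‖(Torus.geometry d).sepVec
        (freeFlight (Torus.geometry d)
          (pairHitTime ε ((Torus.geometry d).sepVec (z i).1 (z j).1) ((z i).2 - (z j).2)) z k).1
        (freeFlight (Torus.geometry d)
          (pairHitTime ε ((Torus.geometry d).sepVec (z i).1 (z j).1) ((z i).2 - (z j).2)) z l).1‖ := by
  have ht' : |pairHitTime ε ((Torus.geometry d).sepVec (z i).1 (z j).1) ((z i).2 - (z j).2)| ≤ δ := by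
    rw [abs_of_nonneg h.hitTime_pos.le]; exact h.hitTime_le
  exact lt_norm_sepVec_freeFlight_of_far h.norm_vel_le h.window (h.othersFar k l hkl hne) ht'

/-- At the hitting time the configuration is in the domain. [folklore] -/
theorem freeFlight_hitTime_mem :
    freeFlight (Torus.geometry d)
        (pairHitTime ε ((Torus.geometry d).sepVec (z i).1 (z j).1) ((z i).2 - (z j).2)) z ∈
      hardSphereDomain (Torus.geometry d) N ε := by
  refine mem_hardSphereDomain_of_othersFar (ε := ε) (r := 0) le_rfl (i := i) (j := j)
    (fun k l hkl hne => ?_) ?_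
  · rw [add_zero]; exact h.lt_norm_sepVec_freeFlight_hitTime_of_ne hkl hne
  · rw [h.sepVec_freeFlight_hitTime, h.norm_hitPoint]

/-- At the hitting time the pair is in contact. [folklore] -/
theorem freeFlight_hitTime_mem_contactSet :
    freeFlight (Torus.geometry d)
        (pairHitTime ε ((Torus.geometry d).sepVec (z i).1 (z j).1) ((z i).2 - (z j).2)) z ∈
      contactSet (Torus.geometry d) N ε i j :=
  ⟨h.freeFlight_hitTime_mem, by rw [h.sepVec_freeFlight_hitTime, h.norm_hitPoint]⟩

/-- At the hitting time the pair is incoming (non-grazing). [folklore] -/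
theorem isIncoming_freeFlight_hitTime :
    IsIncoming (Torus.geometry d) (freeFlight (Torus.geometry d)
        (pairHitTime ε ((Torus.geometry d).sepVec (z i).1 (z j).1) ((z i).2 - (z j).2)) z) i j := by
  unfold IsIncoming
  rw [h.sepVec_freeFlight_hitTime]
  simpa only [freeFlight_apply] using inner_hitPoint_neg h.good

/-- **At the hitting time the configuration is simple incoming with colliding pair `(i, j)`.** [folklore] -/
theorem isSimpleIncomingWith_freeFlight_hitTime :
    IsSimpleIncomingWith (Torus.geometry d) ε (freeFlight (Torus.geometry d)
        (pairHitTime ε ((Torus.geometry d).sepVec (z i).1 (z j).1) ((z i).2 - (z j).2)) z) (i, j) := by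
  refine ⟨h.lt, h.isIncoming_freeFlight_hitTime, fun k l hkl => ⟨fun hc => ?_, fun hkl' => ?_⟩⟩
  · by_contra hne
    exact (h.lt_norm_sepVec_freeFlight_hitTime_of_ne hkl hne).ne' hc.2
  · rcases finsetPair_eq_iff.1 hkl' with ⟨rfl, rfl⟩ | ⟨rfl, rfl⟩
    · exact h.freeFlight_hitTime_mem_contactSet
    · exact (Torus.isHardSphereRegular_geometry h.ε_lt).mem_contactSet_comm.1
        h.freeFlight_hitTime_mem_contactSet

/-- **The exit time is the hitting time**: `τ(z) = τ₀`. [folklore] -/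
theorem freeExitTime_eq :
    freeExitTime (Torus.geometry d) ε z =
      ENNReal.ofReal (pairHitTime ε ((Torus.geometry d).sepVec (z i).1 (z j).1)
        ((z i).2 - (z j).2)) := by
  have hge : ENNReal.ofReal (pairHitTime ε ((Torus.geometry d).sepVec (z i).1 (z j).1)
      ((z i).2 - (z j).2)) ≤ freeExitTime (Torus.geometry d) ε z := by
    refine le_freeExitTime_of_forall_mem fun t ht0 htlt => ?_
    have ht : t < pairHitTime ε ((Torus.geometry d).sepVec (z i).1 (z j).1) ((z i).2 - (z j).2) :=
      (ENNReal.ofReal_lt_ofReal_iff_of_nonneg ht0).1 htlt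
    exact fun k l hkl => (h.lt_norm_sepVec_freeFlight_of_lt ht0 ht hkl).le
  have h0 := freeExitTime_eq_zero_of_isIncoming (Torus.isHardSphereRegular_geometry h.ε_lt) h.ne
    h.freeFlight_hitTime_mem_contactSet h.isIncoming_freeFlight_hitTime
  have hadd := freeExitTime_freeFlight_add (G := Torus.geometry d) (ε := ε) h.hitTime_pos.le hge
  rw [h0, zero_add] at hadd
  exact hadd.symm

/-- The exit time is finite. [folklore] -/
theorem freeExitTime_ne_top : freeExitTime (Torus.geometry d) ε z ≠ ∞ := by
  rw [h.freeExitTime_eq]; exact ENNReal.ofReal_ne_top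

/-- The exit time as a real number. [folklore] -/
theorem toReal_freeExitTime :
    (freeExitTime (Torus.geometry d) ε z).toReal =
      pairHitTime ε ((Torus.geometry d).sepVec (z i).1 (z j).1) ((z i).2 - (z j).2) := by
  rw [h.freeExitTime_eq, ENNReal.toReal_ofReal h.hitTime_pos.le]

/-- **The collision step is the collision of the pair at the hitting time**:
`T z = C_{ij} (S_{τ₀} z)`. [folklore] -/
theorem collisionStep_eq :
    collisionStep (Torus.geometry d) ε z =
      collidePair (Torus.geometry d) i j (freeFlight (Torus.geometry d)
        (pairHitTime ε ((Torus.geometry d).sepVec (z i).1 (z j).1) ((z i).2 - (z j).2)) z) := by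
  have hs := h.isSimpleIncomingWith_freeFlight_hitTime
  rw [← h.toReal_freeExitTime] at hs ⊢
  exact collisionStep_eq_collidePair h.freeExitTime_ne_top hs

/-- The first post-collisional state. [folklore] -/
theorem stateAfter_one :
    stateAfter (Torus.geometry d) ε z 1 =
      collidePair (Torus.geometry d) i j (freeFlight (Torus.geometry d)
        (pairHitTime ε ((Torus.geometry d).sepVec (z i).1 (z j).1) ((z i).2 - (z j).2)) z) := by
  rw [Alexander.stateAfter_one, h.collisionStep_eq]

/-- The post-collisional state has the positions of the configuration at the hitting time. [folklore] -/
theorem stateAfter_one_apply_fst (k : Fin N) :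
    (stateAfter (Torus.geometry d) ε z 1 k).1 = (freeFlight (Torus.geometry d)
        (pairHitTime ε ((Torus.geometry d).sepVec (z i).1 (z j).1) ((z i).2 - (z j).2)) z k).1 := by
  rw [h.stateAfter_one, collidePair_apply_fst]

/-- The post-collisional state is on the same energy shell, so its speeds are `≤ V`. [folklore] -/
theorem norm_vel_stateAfter_one_le (k : Fin N) : ‖(stateAfter (Torus.geometry d) ε z 1 k).2‖ ≤ V := by
  refine norm_vel_le_of_configEnergy_le h.V_nonneg ?_ k
  rw [h.stateAfter_one, configEnergy_collidePair h.ne, configEnergy_freeFlight]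
  exact h.energy

/-- **The post-collisional relative velocity is the billiard one**: `v_i' - v_j' = hitVel`. [folklore] -/
theorem vel_stateAfter_one_sub :
    (stateAfter (Torus.geometry d) ε z 1 i).2 - (stateAfter (Torus.geometry d) ε z 1 j).2 =
      hitVel ε ((Torus.geometry d).sepVec (z i).1 (z j).1, (z i).2 - (z j).2) := by
  rw [h.stateAfter_one, collidePair_apply_left h.ne, collidePair_apply_right,
    h.sepVec_freeFlight_hitTime, hitVel_eq]
  simp only [freeFlight_apply, reflectVel, h.norm_hitPoint, real_inner_comm]
  module

/-- The post-collisional velocity of `i`: `v_i' = v_i - b`. [folklore] -/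
theorem vel_stateAfter_one_left :
    (stateAfter (Torus.geometry d) ε z 1 i).2 = (z i).2 - pairImpulse ε z i j := by
  rw [h.stateAfter_one, collidePair_apply_left h.ne, h.sepVec_freeFlight_hitTime, pairImpulse]
  simp only [freeFlight_apply, reflectVel, h.norm_hitPoint, real_inner_comm]

/-- The post-collisional velocity of `j`: `v_j' = v_j + b`. [folklore] -/
theorem vel_stateAfter_one_right :
    (stateAfter (Torus.geometry d) ε z 1 j).2 = (z j).2 + pairImpulse ε z i j := by
  rw [h.stateAfter_one, collidePair_apply_right, h.sepVec_freeFlight_hitTime, pairImpulse]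
  simp only [freeFlight_apply, reflectVel, h.norm_hitPoint, real_inner_comm]

/-- The other velocities are unchanged. [folklore] -/
theorem stateAfter_one_apply_of_ne {k : Fin N} (hki : k ≠ i) (hkj : k ≠ j) :
    stateAfter (Torus.geometry d) ε z 1 k = freeFlight (Torus.geometry d)
        (pairHitTime ε ((Torus.geometry d).sepVec (z i).1 (z j).1) ((z i).2 - (z j).2)) z k := by
  rw [h.stateAfter_one, collidePair_apply_of_ne hki hkj]

/-- **After the collision no pair is in contact until the end of the window**: for
`0 < t` with `τ₀ + t ≤ δ`, every pair of `S_t z₁` is at distance `> ε` (the collided pair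
separates, `lt_norm_hitPoint_add_smul_hitVel`; the others are still far). [folklore] -/
theorem lt_norm_sepVec_freeFlight_stateAfter_one {t : ℝ} (ht : 0 < t)
    (htδ : pairHitTime ε ((Torus.geometry d).sepVec (z i).1 (z j).1) ((z i).2 - (z j).2) + t ≤ δ)
    {k l : Fin N} (hkl : k ≠ l) :
    ε < ‖(Torus.geometry d).sepVec
        (freeFlight (Torus.geometry d) t (stateAfter (Torus.geometry d) ε z 1) k).1
        (freeFlight (Torus.geometry d) t (stateAfter (Torus.geometry d) ε z 1) l).1‖ := by
  have htδ' : |t| ≤ δ := by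
    rw [abs_of_pos ht]; linarith [h.hitTime_pos.le]
  -- the collided pair
  have hij : ε < ‖(Torus.geometry d).sepVec
      (freeFlight (Torus.geometry d) t (stateAfter (Torus.geometry d) ε z 1) i).1
      (freeFlight (Torus.geometry d) t (stateAfter (Torus.geometry d) ε z 1) j).1‖ := by
    have hsep : (Torus.geometry d).sepVec (stateAfter (Torus.geometry d) ε z 1 i).1
        (stateAfter (Torus.geometry d) ε z 1 j).1 =
          hitPoint ε ((Torus.geometry d).sepVec (z i).1 (z j).1, (z i).2 - (z j).2) := by
      rw [h.stateAfter_one_apply_fst, h.stateAfter_one_apply_fst, h.sepVec_freeFlight_hitTime]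
    have hchart : ‖(Torus.geometry d).sepVec (stateAfter (Torus.geometry d) ε z 1 i).1
        (stateAfter (Torus.geometry d) ε z 1 j).1‖ +
          |t| * ‖(stateAfter (Torus.geometry d) ε z 1 i).2 -
            (stateAfter (Torus.geometry d) ε z 1 j).2‖ < 1 / 2 := by
      rw [hsep, h.norm_hitPoint, h.vel_stateAfter_one_sub, norm_hitVel h.ε_pos h.good]
      have hw := norm_vel_sub_le h.norm_vel_le i j
      have h1 : |t| * ‖(z i).2 - (z j).2‖ ≤ δ * (2 * V) :=
        mul_le_mul htδ' hw (norm_nonneg _) h.δ_pos.le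
      have : (2⁻¹ : ℝ) = 1 / 2 := by norm_num
      nlinarith [h.chart, h.window, h.r_nonneg]
    rw [sepVec_freeFlight_eq hchart, hsep, h.vel_stateAfter_one_sub]
    exact lt_norm_hitPoint_add_smul_hitVel h.ε_pos h.good ht
  refine lt_norm_sepVec_of_othersFar (ε := ε) (r := 0) le_rfl
    (z := freeFlight (Torus.geometry d) t (stateAfter (Torus.geometry d) ε z 1)) (i := i) (j := j)
    (fun k l hkl hne => ?_) hij hkl
  rw [add_zero]
  refine lt_norm_sepVec_freeFlight_of_far₂ h.norm_vel_le h.norm_vel_stateAfter_one_le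
    h.stateAfter_one_apply_fst h.window h.hitTime_pos.le ?_ (h.othersFar k l hkl hne)
  rw [abs_of_pos ht]; exact htδ

/-- The post-collisional state lies in the domain. [folklore] -/
theorem stateAfter_one_mem : stateAfter (Torus.geometry d) ε z 1 ∈ hardSphereDomain (Torus.geometry d) N ε := by
  rw [h.stateAfter_one, collidePair_mem_hardSphereDomain_iff]
  exact h.freeFlight_hitTime_mem

/-- **The post-collisional state does not collide again within the window**:
`τ(z₁) > δ - τ₀`. [folklore] -/
theorem ofReal_lt_freeExitTime_stateAfter_one :
    ENNReal.ofReal (δ - pairHitTime ε ((Torus.geometry d).sepVec (z i).1 (z j).1)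
        ((z i).2 - (z j).2)) < freeExitTime (Torus.geometry d) ε (stateAfter (Torus.geometry d) ε z 1) := by
  have hG := Torus.isHardSphereRegular_geometry (d := d) h.ε_lt
  set τ₀ := pairHitTime ε ((Torus.geometry d).sepVec (z i).1 (z j).1) ((z i).2 - (z j).2) with hτ₀
  by_contra hle
  rw [not_lt] at hle
  have hfin : freeExitTime (Torus.geometry d) ε (stateAfter (Torus.geometry d) ε z 1) ≠ ∞ :=
    ne_top_of_le_ne_top ENNReal.ofReal_ne_top hle
  obtain ⟨k, l, hkl, hc, hin⟩ :=
    exists_isIncoming_freeFlight_freeExitTime hG h.stateAfter_one_mem hfin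
  have hτ1 : (freeExitTime (Torus.geometry d) ε (stateAfter (Torus.geometry d) ε z 1)).toReal ≤ δ - τ₀ :=
    ENNReal.toReal_le_of_le_ofReal (by linarith [h.hitTime_le]) hle
  rcases (ENNReal.toReal_nonneg :
      0 ≤ (freeExitTime (Torus.geometry d) ε (stateAfter (Torus.geometry d) ε z 1)).toReal).eq_or_lt
    with h0 | hpos
  · -- immediate exit: but the contact pairs of `z₁` are outgoing
    rw [← h0, freeFlight_zero] at hc hin
    have hc' : freeFlight (Torus.geometry d) τ₀ z ∈ contactSet (Torus.geometry d) N ε k l :=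
      (mem_contactSet_congr_fst fun m => (h.stateAfter_one_apply_fst m)).1 hc
    have hout := h.isSimpleIncomingWith_freeFlight_hitTime.isOutgoing_collidePair hG hkl hc'
    rw [← h.stateAfter_one] at hout
    exact lt_asymm hin hout
  · have key := h.lt_norm_sepVec_freeFlight_stateAfter_one hpos (by linarith) hkl
    exact key.ne' hc.2

/-- The second collision instant is beyond the window. [folklore] -/
theorem ofReal_lt_collisionInstant_two :
    ENNReal.ofReal δ < collisionInstant (Torus.geometry d) ε z 2 := by
  rw [collisionInstant_succ, collisionInstant_one, h.freeExitTime_eq]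
  have hsplit : ENNReal.ofReal δ = ENNReal.ofReal (pairHitTime ε ((Torus.geometry d).sepVec (z i).1
      (z j).1) ((z i).2 - (z j).2)) + ENNReal.ofReal (δ - pairHitTime ε
        ((Torus.geometry d).sepVec (z i).1 (z j).1) ((z i).2 - (z j).2)) := by
    rw [← ENNReal.ofReal_add h.hitTime_pos.le (by linarith [h.hitTime_le]), add_sub_cancel]
  rw [hsplit]
  exact ENNReal.add_lt_add_left ENNReal.ofReal_ne_top h.ofReal_lt_freeExitTime_stateAfter_one

/-- **One collision during the window: forward regularity up to `δ`.** [folklore] -/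
theorem fwdGoodUpTo : FwdGoodUpTo (Torus.geometry d) ε δ z := by
  have h2 := h.ofReal_lt_collisionInstant_two
  have hk2 : ∀ k, 2 ≤ k → ¬ collisionInstant (Torus.geometry d) ε z k ≤ ENNReal.ofReal δ :=
    fun k hk hle => (not_le.2 h2) ((monotone_collisionInstant z hk).trans hle)
  refine ⟨fun k hk => ?_, fun k t ht htk hkt a b hab => ?_, ⟨2, h2⟩⟩
  · cases k with
    | zero =>
      rw [stateAfter_zero, h.toReal_freeExitTime]
      exact ⟨(i, j), h.isSimpleIncomingWith_freeFlight_hitTime⟩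
    | succ k => exact (hk2 (k + 2) (by omega) hk).elim
  · match k with
    | 0 =>
      rw [stateAfter_zero]
      rw [stateAfter_zero, h.freeExitTime_eq, ENNReal.ofReal_lt_ofReal_iff_of_nonneg ht.le] at htk
      exact fun hc => (h.lt_norm_sepVec_freeFlight_of_lt ht.le htk hab).ne' hc.2
    | 1 =>
      rw [collisionInstant_one, h.freeExitTime_eq, ← ENNReal.ofReal_add h.hitTime_pos.le ht.le,
        ENNReal.ofReal_le_ofReal_iff h.δ_pos.le] at hkt
      exact fun hc => (h.lt_norm_sepVec_freeFlight_stateAfter_one ht hkt hab).ne' hc.2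
    | k + 2 => exact (hk2 (k + 2) (by omega) ((le_add_right le_rfl).trans hkt)).elim

/-- **One collision during the window: the flow at time `δ`** is the free flight of the
post-collisional state for the remaining time, `Φ_δ z = S_{δ - τ₀} z₁`. [folklore] -/
theorem fwdFlow_eq :
    fwdFlow (Torus.geometry d) ε z δ = freeFlight (Torus.geometry d)
      (δ - pairHitTime ε ((Torus.geometry d).sepVec (z i).1 (z j).1) ((z i).2 - (z j).2))
      (stateAfter (Torus.geometry d) ε z 1) := by
  have h1 : collisionInstant (Torus.geometry d) ε z 1 ≤ ENNReal.ofReal δ := by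
    rw [collisionInstant_one, h.freeExitTime_eq]; exact ENNReal.ofReal_le_ofReal h.hitTime_le
  rw [fwdFlow_eq_of_segment h1 h.ofReal_lt_collisionInstant_two, collisionInstant_one,
    h.toReal_freeExitTime]

/-- **The post-collisional state flowed back to time `0` is `pairCollide ε i j z`.** [folklore] -/
theorem freeFlight_neg_stateAfter_one :
    freeFlight (Torus.geometry d)
        (-pairHitTime ε ((Torus.geometry d).sepVec (z i).1 (z j).1) ((z i).2 - (z j).2))
        (stateAfter (Torus.geometry d) ε z 1) = pairCollide ε i j z := by
  funext k
  by_cases hkj : k = j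
  · rw [hkj]
    refine Prod.ext ?_ ?_
    · simp only [freeFlight_apply, Torus.geometry_translate, pairCollide_apply_right,
        h.vel_stateAfter_one_right, h.stateAfter_one_apply_fst]
      rw [add_assoc, ← FunctionSpaces.Torus.proj_add, sub_eq_add_neg (z j).1, ← FunctionSpaces.Torus.proj_neg]
      congr 2
      module
    · simp only [freeFlight_apply, pairCollide_apply_right, h.vel_stateAfter_one_right]
  by_cases hki : k = i
  · rw [hki]
    refine Prod.ext ?_ ?_
    · simp only [freeFlight_apply, Torus.geometry_translate, pairCollide_apply_left h.ne,
        h.vel_stateAfter_one_left, h.stateAfter_one_apply_fst]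
      rw [add_assoc, ← FunctionSpaces.Torus.proj_add]
      congr 2
      module
    · simp only [freeFlight_apply, pairCollide_apply_left h.ne, h.vel_stateAfter_one_left]
  · refine Prod.ext ?_ ?_
    · simp only [freeFlight_apply, Torus.geometry_translate, pairCollide_apply_of_ne hki hkj,
        h.stateAfter_one_apply_of_ne hki hkj]
      rw [add_assoc, ← FunctionSpaces.Torus.proj_add, neg_smul, add_neg_cancel, FunctionSpaces.Torus.proj_zero, add_zero]
    · simp only [freeFlight_apply, pairCollide_apply_of_ne hki hkj,
        h.stateAfter_one_apply_of_ne hki hkj]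

/-- **One collision during the window: `Φ_δ z = S_δ (pairCollide ε i j z)`.** [folklore] -/
theorem fwdFlow_eq_freeFlight_pairCollide :
    fwdFlow (Torus.geometry d) ε z δ = freeFlight (Torus.geometry d) δ (pairCollide ε i j z) := by
  rw [h.fwdFlow_eq, ← h.freeFlight_neg_stateAfter_one, ← freeFlight_add, sub_eq_add_neg]

/-- The post-collisional state recovered from `pairCollide`: `S_{τ₀} (pairCollide ε i j z) = z₁`. [folklore] -/
theorem freeFlight_pairCollide :
    freeFlight (Torus.geometry d)
        (pairHitTime ε ((Torus.geometry d).sepVec (z i).1 (z j).1) ((z i).2 - (z j).2))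
        (pairCollide ε i j z) = stateAfter (Torus.geometry d) ε z 1 := by
  rw [← h.freeFlight_neg_stateAfter_one, ← freeFlight_add, add_neg_cancel, freeFlight_zero]

end HitHyp

/-! ## The short-time good set: regularity, the one-step map, injectivity -/

section ShortGood

variable {ε r δ V : ℝ} {z : Config N d (UnitAddTorus d)}

/-- Two ordered pairs `i < j`, `k < l` with the same underlying two-element set coincide. [folklore] -/
theorem eq_of_pair_eq_of_lt {i j k l : Fin N} (hij : i < j) (hkl : k < l)
    (h : ({k, l} : Finset (Fin N)) = {i, j}) : k = i ∧ l = j := by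
  rcases finsetPair_eq_iff.1 h with h | ⟨rfl, rfl⟩
  · exact h
  · exact ((lt_asymm hij) hkl).elim

/-- A far configuration is in no hit piece. [folklore] -/
theorem not_mem_hitPiece_of_mem_farSet (hz : z ∈ farSet N ε r) {k l : Fin N} (hkl : k ≠ l) :
    z ∉ hitPiece N ε r δ k l :=
  fun h => (not_le.2 (hz k l hkl)) h.2.1

/-- A configuration of a no-hit piece is in no hit piece (ordered pairs). [folklore] -/
theorem not_mem_hitPiece_of_mem_noHitPiece {i j : Fin N} (hij : i < j)
    (hz : z ∈ noHitPiece N ε r δ i j) {k l : Fin N} (hkl : k < l) :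
    z ∉ hitPiece N ε r δ k l := by
  intro h
  by_cases hp : ({k, l} : Finset (Fin N)) = {i, j}
  · obtain ⟨rfl, rfl⟩ := eq_of_pair_eq_of_lt hij hkl hp
    rcases hz.2.2.2 with hnh | hnh
    · exact hnh (PairHits.of_mem_billiardGood h.2.2.1)
    · exact (not_le.2 hnh) h.2.2.2
  · exact (not_le.2 (hz.1 k l hkl.ne hp)) h.2.1

/-- Two hit pieces of different ordered pairs are disjoint. [folklore] -/
theorem eq_of_mem_hitPiece_of_mem_hitPiece {i j k l : Fin N} (hij : i < j) (hkl : k < l)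
    (hz : z ∈ hitPiece N ε r δ i j) (hz' : z ∈ hitPiece N ε r δ k l) : k = i ∧ l = j := by
  by_cases hp : ({k, l} : Finset (Fin N)) = {i, j}
  · exact eq_of_pair_eq_of_lt hij hkl hp
  · exact ((not_le.2 (hz.1 k l hkl.ne hp)) hz'.2.1).elim

open Classical in
variable (N) in
/-- **The one-step collision map of the window** ("kick"): `pairCollide ε i j` on the hit
piece of `(i, j)`, `i < j`, and the identity elsewhere; on the short-time good set the flow at
time `δ` is `S_δ ∘ kick` (`fwdFlow_eq_freeFlight_kick`). [folklore] -/
def kick (ε r δ : ℝ) (z : Config N d (UnitAddTorus d)) : Config N d (UnitAddTorus d) :=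
  if h : ∃ p : Fin N × Fin N, p.1 < p.2 ∧ z ∈ hitPiece N ε r δ p.1 p.2 then
    pairCollide ε h.choose.1 h.choose.2 z
  else z

/-- On a hit piece the kick is the two-body collision map of its pair. [folklore] -/
theorem kick_eq_pairCollide {i j : Fin N} (hij : i < j) (hz : z ∈ hitPiece N ε r δ i j) :
    kick N ε r δ z = pairCollide ε i j z := by
  classical
  have hex : ∃ p : Fin N × Fin N, p.1 < p.2 ∧ z ∈ hitPiece N ε r δ p.1 p.2 := ⟨(i, j), hij, hz⟩
  rw [kick, dif_pos hex]
  obtain ⟨h1, h2⟩ := eq_of_mem_hitPiece_of_mem_hitPiece hij hex.choose_spec.1 hz hex.choose_spec.2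
  rw [h1, h2]

/-- Off the hit pieces the kick is the identity. [folklore] -/
theorem kick_eq_self (hz : ∀ k l : Fin N, k < l → z ∉ hitPiece N ε r δ k l) : kick N ε r δ z = z := by
  classical
  rw [kick, dif_neg]
  rintro ⟨p, hp, hmem⟩
  exact hz p.1 p.2 hp hmem

/-- On the far set the kick is the identity. [folklore] -/
theorem kick_eq_self_of_mem_farSet (hz : z ∈ farSet N ε r) : kick N ε r δ z = z :=
  kick_eq_self fun _ _ hkl => not_mem_hitPiece_of_mem_farSet hz hkl.ne

/-- On a no-hit piece the kick is the identity. [folklore] -/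
theorem kick_eq_self_of_mem_noHitPiece {i j : Fin N} (hij : i < j)
    (hz : z ∈ noHitPiece N ε r δ i j) : kick N ε r δ z = z :=
  kick_eq_self fun _ _ hkl => not_mem_hitPiece_of_mem_noHitPiece hij hz hkl

/-- **Forward regularity up to `δ` on the short-time good set** (energy shell `E ≤ V²/2`,
`2Vδ ≤ r`, `ε + 2r < 1/2`). [cite: GST2013, proof of Prop. 4.1.1 p. 19] -/
theorem fwdGoodUpTo_of_mem_shortGood (hε : 0 < ε) (hεr : ε + 2 * r < 2⁻¹) (hr : 2 * V * δ ≤ r)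
    (hV0 : 0 ≤ V) (hδ : 0 ≤ δ) (hE : configEnergy z ≤ V ^ 2 / 2)
    (hz : z ∈ shortGood N ε r δ) : FwdGoodUpTo (Torus.geometry d) ε δ z := by
  have hV : ∀ i, ‖(z i).2‖ ≤ V := norm_vel_le_of_configEnergy_le hV0 hE
  have hr0 : 0 ≤ r := le_trans (by positivity) hr
  have hε' : ε < 2⁻¹ := by linarith
  rcases mem_shortGood.1 hz with h | ⟨p, hp, h | h⟩
  · exact fwdGoodUpTo_of_forall_lt_norm hε' hδ (forall_lt_norm_of_mem_farSet hV hr h)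
  · exact fwdGoodUpTo_of_forall_lt_norm hε' hδ (forall_lt_norm_of_mem_noHitPiece hε hV hr hεr h)
  · exact (HitHyp.mk hε hεr hr hV0 hE hp h).fwdGoodUpTo

/-- **The flow at time `δ` on the short-time good set is `S_δ ∘ kick`.** [cite: GST2013, proof of Prop. 4.1.1 p. 19] -/
theorem fwdFlow_eq_freeFlight_kick (hε : 0 < ε) (hεr : ε + 2 * r < 2⁻¹) (hr : 2 * V * δ ≤ r)
    (hV0 : 0 ≤ V) (hδ : 0 ≤ δ) (hE : configEnergy z ≤ V ^ 2 / 2)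
    (hz : z ∈ shortGood N ε r δ) :
    fwdFlow (Torus.geometry d) ε z δ = freeFlight (Torus.geometry d) δ (kick N ε r δ z) := by
  have hV : ∀ i, ‖(z i).2‖ ≤ V := norm_vel_le_of_configEnergy_le hV0 hE
  have hr0 : 0 ≤ r := le_trans (by positivity) hr
  have hε' : ε < 2⁻¹ := by linarith
  rcases mem_shortGood.1 hz with h | ⟨p, hp, h | h⟩
  · rw [kick_eq_self_of_mem_farSet h]
    exact fwdFlow_eq_freeFlight_of_forall_lt_norm hε' hδ (forall_lt_norm_of_mem_farSet hV hr h)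
      ⟨hδ, le_rfl⟩
  · rw [kick_eq_self_of_mem_noHitPiece hp h]
    exact fwdFlow_eq_freeFlight_of_forall_lt_norm hε' hδ
      (forall_lt_norm_of_mem_noHitPiece hε hV hr hεr h) ⟨hδ, le_rfl⟩
  · rw [kick_eq_pairCollide hp h]
    exact (HitHyp.mk hε hεr hr hV0 hE hp h).fwdFlow_eq_freeFlight_pairCollide

/-- The flow stays on the short-time pieces' common domain: `Φ_s z ∈ D` for `s ∈ [0, δ]`. [folklore] -/
theorem fwdFlow_mem_of_mem_shortGood (hε : 0 < ε) (hεr : ε + 2 * r < 2⁻¹) (hr : 2 * V * δ ≤ r)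
    (hV0 : 0 ≤ V) (hδ : 0 ≤ δ) (hE : configEnergy z ≤ V ^ 2 / 2)
    (hz : z ∈ shortGood N ε r δ) {s : ℝ} (hs : s ∈ Icc (0 : ℝ) δ) :
    fwdFlow (Torus.geometry d) ε z s ∈ hardSphereDomain (Torus.geometry d) N ε :=
  (fwdGoodUpTo_of_mem_shortGood hε hεr hr hV0 hδ hE hz).fwdFlow_mem hs.1 hs.2

/-- A no-collision datum is not the kick of a hit datum: the kicked configuration reaches the
contact of its pair at time `τ₀ ∈ (0, δ]`, a no-collision datum does not. [folklore] -/
theorem HitHyp.pairCollide_ne {i j : Fin N} (h : HitHyp ε r δ V z i j)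
    {z' : Config N d (UnitAddTorus d)}
    (H : ∀ t ∈ Icc (0 : ℝ) δ, ∀ k l : Fin N, k ≠ l →
      ε < ‖(Torus.geometry d).sepVec (freeFlight (Torus.geometry d) t z' k).1
        (freeFlight (Torus.geometry d) t z' l).1‖) :
    pairCollide ε i j z ≠ z' := by
  intro heq
  have hc : stateAfter (Torus.geometry d) ε z 1 ∈ contactSet (Torus.geometry d) N ε i j :=
    (mem_contactSet_congr_fst fun m => (h.stateAfter_one_apply_fst m)).2
      h.freeFlight_hitTime_mem_contactSet
  rw [← h.freeFlight_pairCollide, heq] at hc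
  exact (H _ ⟨h.hitTime_pos.le, h.hitTime_le⟩ i j h.ne).ne' hc.2

/-- The hitting times of two hit data with the same kick agree in one direction. [folklore] -/
theorem HitHyp.hitTime_le_of_pairCollide_eq {i j k l : Fin N} (h : HitHyp ε r δ V z i j)
    {z' : Config N d (UnitAddTorus d)} (h' : HitHyp ε r δ V z' k l)
    (heq : pairCollide ε i j z = pairCollide ε k l z') :
    pairHitTime ε ((Torus.geometry d).sepVec (z' k).1 (z' l).1) ((z' k).2 - (z' l).2) ≤
      pairHitTime ε ((Torus.geometry d).sepVec (z i).1 (z j).1) ((z i).2 - (z j).2) := by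
  by_contra hlt
  rw [not_le] at hlt
  -- at time `τ₀'` the pair `(k, l)` of `S_{τ₀'} (pairCollide …) = S_{τ₀' - τ₀} z₁` is in contact
  have hc : freeFlight (Torus.geometry d)
      (pairHitTime ε ((Torus.geometry d).sepVec (z' k).1 (z' l).1) ((z' k).2 - (z' l).2))
      (pairCollide ε i j z) ∈ contactSet (Torus.geometry d) N ε k l := by
    rw [heq, h'.freeFlight_pairCollide]
    exact (mem_contactSet_congr_fst fun m => (h'.stateAfter_one_apply_fst m)).2
      h'.freeFlight_hitTime_mem_contactSet
  have hsplit : freeFlight (Torus.geometry d)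
      (pairHitTime ε ((Torus.geometry d).sepVec (z' k).1 (z' l).1) ((z' k).2 - (z' l).2))
      (pairCollide ε i j z) = freeFlight (Torus.geometry d)
      (pairHitTime ε ((Torus.geometry d).sepVec (z' k).1 (z' l).1) ((z' k).2 - (z' l).2) -
        pairHitTime ε ((Torus.geometry d).sepVec (z i).1 (z j).1) ((z i).2 - (z j).2))
      (stateAfter (Torus.geometry d) ε z 1) := by
    rw [← h.freeFlight_pairCollide, ← freeFlight_add, sub_add_cancel]
  rw [hsplit] at hc
  have key := h.lt_norm_sepVec_freeFlight_stateAfter_one (sub_pos.2 hlt)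
    (by linarith [h'.hitTime_le]) h'.ne
  exact key.ne' hc.2

/-- **Two hit data with the same kick coincide** (the backward free flight of the kicked
configuration first reaches a contact at the common hitting time, in the common pair; the
collision law is an involution). [folklore] -/
theorem HitHyp.eq_of_pairCollide_eq {i j k l : Fin N} (h : HitHyp ε r δ V z i j)
    {z' : Config N d (UnitAddTorus d)} (h' : HitHyp ε r δ V z' k l)
    (heq : pairCollide ε i j z = pairCollide ε k l z') : z = z' := by
  have hG := Torus.isHardSphereRegular_geometry (d := d) h.ε_lt
  have hτ : pairHitTime ε ((Torus.geometry d).sepVec (z i).1 (z j).1) ((z i).2 - (z j).2) =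
      pairHitTime ε ((Torus.geometry d).sepVec (z' k).1 (z' l).1) ((z' k).2 - (z' l).2) :=
    le_antisymm (h'.hitTime_le_of_pairCollide_eq h heq.symm) (h.hitTime_le_of_pairCollide_eq h' heq)
  -- the post-collisional states agree
  have h1 : stateAfter (Torus.geometry d) ε z 1 = stateAfter (Torus.geometry d) ε z' 1 := by
    rw [← h.freeFlight_pairCollide, ← h'.freeFlight_pairCollide, heq, hτ]
  -- hence the pairs agree
  have hc : stateAfter (Torus.geometry d) ε z 1 ∈ contactSet (Torus.geometry d) N ε i j :=
    (mem_contactSet_congr_fst fun m => (h.stateAfter_one_apply_fst m)).2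
      h.freeFlight_hitTime_mem_contactSet
  rw [h1] at hc
  have hc' := (mem_contactSet_congr_fst fun m => (h'.stateAfter_one_apply_fst m)).1 hc
  obtain ⟨rfl, rfl⟩ := eq_of_pair_eq_of_lt h'.lt h.lt
    ((h'.isSimpleIncomingWith_freeFlight_hitTime.2.2 i j h.ne).1 hc')
  -- and the pre-collisional configurations agree
  rw [h.stateAfter_one, h'.stateAfter_one, ← hτ] at h1
  have h2 := congrArg (collidePair (Torus.geometry d) i j) h1
  rw [collidePair_collidePair h.ne, collidePair_collidePair h.ne] at h2
  have h3 := congrArg (freeFlight (Torus.geometry d)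
    (-pairHitTime ε ((Torus.geometry d).sepVec (z i).1 (z j).1) ((z i).2 - (z j).2))) h2
  rwa [← freeFlight_add, ← freeFlight_add, neg_add_cancel, freeFlight_zero, freeFlight_zero] at h3

/-- **The kick is injective on the short-time good part of an energy shell.** [folklore] -/
theorem kick_injOn (hε : 0 < ε) (hεr : ε + 2 * r < 2⁻¹) (hr : 2 * V * δ ≤ r) (hV0 : 0 ≤ V) :
    InjOn (kick N ε r δ)
      (shortGood N ε r δ ∩ {z : Config N d (UnitAddTorus d) | configEnergy z ≤ V ^ 2 / 2}) := by
  -- the no-collision property of the non-hit pieces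
  have Hnc : ∀ z : Config N d (UnitAddTorus d), configEnergy z ≤ V ^ 2 / 2 →
      (z ∈ farSet N ε r ∨ ∃ p : Fin N × Fin N, p.1 < p.2 ∧ z ∈ noHitPiece N ε r δ p.1 p.2) →
      ∀ t ∈ Icc (0 : ℝ) δ, ∀ k l : Fin N, k ≠ l →
        ε < ‖(Torus.geometry d).sepVec (freeFlight (Torus.geometry d) t z k).1
          (freeFlight (Torus.geometry d) t z l).1‖ := by
    intro z hE hz
    have hV : ∀ i, ‖(z i).2‖ ≤ V := norm_vel_le_of_configEnergy_le hV0 hE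
    rcases hz with h | ⟨p, hp, h⟩
    · exact forall_lt_norm_of_mem_farSet hV hr h
    · exact forall_lt_norm_of_mem_noHitPiece hε hV hr hεr h
  -- trichotomy of a short-good datum: non-hit, or hit with its ordered pair
  have tri : ∀ z : Config N d (UnitAddTorus d), z ∈ shortGood N ε r δ →
      (z ∈ farSet N ε r ∨ ∃ p : Fin N × Fin N, p.1 < p.2 ∧ z ∈ noHitPiece N ε r δ p.1 p.2) ∧
        kick N ε r δ z = z ∨
      ∃ p : Fin N × Fin N, p.1 < p.2 ∧ z ∈ hitPiece N ε r δ p.1 p.2 ∧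
        kick N ε r δ z = pairCollide ε p.1 p.2 z := by
    intro z hz
    rcases mem_shortGood.1 hz with h | ⟨p, hp, h | h⟩
    · exact Or.inl ⟨Or.inl h, kick_eq_self_of_mem_farSet h⟩
    · exact Or.inl ⟨Or.inr ⟨p, hp, h⟩, kick_eq_self_of_mem_noHitPiece hp h⟩
    · exact Or.inr ⟨p, hp, h, kick_eq_pairCollide hp h⟩
  rintro z ⟨hz, hE⟩ z' ⟨hz', hE'⟩ heq
  have hE₀ : configEnergy z ≤ V ^ 2 / 2 := hE
  have hE₀' : configEnergy z' ≤ V ^ 2 / 2 := hE'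
  rcases tri z hz with ⟨hn, hk⟩ | ⟨p, hp, hmem, hk⟩ <;>
    rcases tri z' hz' with ⟨hn', hk'⟩ | ⟨p', hp', hmem', hk'⟩
  · rwa [hk, hk'] at heq
  · rw [hk, hk'] at heq
    exact absurd heq.symm ((HitHyp.mk hε hεr hr hV0 hE₀' hp' hmem').pairCollide_ne (Hnc z hE₀ hn))
  · rw [hk, hk'] at heq
    exact absurd heq ((HitHyp.mk hε hεr hr hV0 hE₀ hp hmem).pairCollide_ne (Hnc z' hE₀' hn'))
  · rw [hk, hk'] at heq
    exact (HitHyp.mk hε hεr hr hV0 hE₀ hp hmem).eq_of_pairCollide_eq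
      (HitHyp.mk hε hεr hr hV0 hE₀' hp' hmem') heq

end ShortGood

/-! ## What is not short-time good is thin -/

section Bad

variable {ε r δ : ℝ}

variable (N) in
/-- The *short-time bad set*: a pair in contact, or two distinct pairs both `r`-close to
contact, or a pair with grazing free relative motion (vanishing discriminant, nonzero relative
velocity) — the three null-or-thin events of GST 2013, proof of Prop. 4.1.1 and Lemma 4.1.2. [cite: GST2013, Lemma 4.1.2] -/
def shortBad (ε r : ℝ) : Set (Config N d (UnitAddTorus d)) :=
  (⋃ p : Fin N × Fin N, {z | p.1 ≠ p.2 ∧ z ∈ contactSet (Torus.geometry d) N ε p.1 p.2}) ∪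
  (⋃ pq : (Fin N × Fin N) × (Fin N × Fin N), {z | pq.1.1 ≠ pq.1.2 ∧ pq.2.1 ≠ pq.2.2 ∧
      ({pq.1.1, pq.1.2} : Finset (Fin N)) ≠ {pq.2.1, pq.2.2} ∧
      z ∈ closePair N d ε r pq.1.1 pq.1.2 ∩ closePair N d ε r pq.2.1 pq.2.2}) ∪
  (⋃ p : Fin N × Fin N, {z | p.1 ≠ p.2 ∧
      pairDisc ε ((Torus.geometry d).sepVec (z p.1).1 (z p.2).1) ((z p.1).2 - (z p.2).2) = 0 ∧
      (z p.1).2 ≠ (z p.2).2})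

/-- **A configuration of the domain outside the short-time good set is short-time bad**
(GST 2013 p. 19: "outside a small measure set" the two possibilities are exhaustive). [cite: GST2013, proof of Prop. 4.1.1 p. 19] -/
theorem mem_shortBad_of_not_mem_shortGood {z : Config N d (UnitAddTorus d)}
    (hz : z ∈ hardSphereDomain (Torus.geometry d) N ε) (hns : z ∉ shortGood N ε r δ) :
    z ∈ shortBad N ε r := by
  simp only [shortBad, mem_union, mem_iUnion, mem_setOf_eq, mem_inter_iff]
  by_contra hbad
  push Not at hbad
  obtain ⟨⟨h1, h2⟩, h3⟩ := hbad
  apply hns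
  -- a close pair exists, else `z` is far
  by_cases hfar : z ∈ farSet N ε r
  · exact mem_shortGood.2 (Or.inl hfar)
  simp only [farSet, mem_setOf_eq, not_forall, not_lt, exists_prop] at hfar
  obtain ⟨a, b, hab, hclose⟩ := hfar
  -- order it
  obtain ⟨i, j, hij, hq⟩ : ∃ i j : Fin N, i < j ∧
      ‖(Torus.geometry d).sepVec (z i).1 (z j).1‖ ≤ ε + r := by
    rcases lt_or_gt_of_ne hab with h | h
    · exact ⟨a, b, h, hclose⟩
    · exact ⟨b, a, h, by rwa [norm_sepVec_comm]⟩
  -- no second close pair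
  have ho : OthersFar ε r z i j := by
    intro k l hkl hne
    by_contra hkl'
    rw [not_lt] at hkl'
    exact h2 ((i, j), (k, l)) hij.ne hkl (Ne.symm hne) ⟨hz i j hij.ne, hq⟩ ⟨hz k l hkl, hkl'⟩
  -- no contact at time `0`
  have hqε : ε < ‖(Torus.geometry d).sepVec (z i).1 (z j).1‖ :=
    lt_of_le_of_ne (hz i j hij.ne) fun heq => h1 (i, j) hij.ne ⟨hz, heq.symm⟩
  refine mem_shortGood.2 (Or.inr ⟨(i, j), hij, ?_⟩)
  by_cases hP : PairHits ε ((Torus.geometry d).sepVec (z i).1 (z j).1) ((z i).2 - (z j).2)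
  · by_cases hτ : δ < pairHitTime ε ((Torus.geometry d).sepVec (z i).1 (z j).1) ((z i).2 - (z j).2)
    · exact Or.inl ⟨ho, hqε, hq, Or.inr hτ⟩
    · rw [not_lt] at hτ
      by_cases hdisc : 0 < pairDisc ε ((Torus.geometry d).sepVec (z i).1 (z j).1) ((z i).2 - (z j).2)
      · exact Or.inr ⟨ho, hq, ⟨hqε, hP.1, hdisc⟩, hτ⟩
      · exfalso
        have hv : (z i).2 = (z j).2 := h3 (i, j) hij.ne (le_antisymm (not_lt.1 hdisc) hP.2)
        have := hP.norm_pos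
        rw [hv, sub_self, norm_zero] at this
        exact lt_irrefl _ this
  · exact Or.inl ⟨ho, hqε, hq, Or.inl hP⟩

/-- **The short-time bad set is thin** (GST 2013 Lemma 4.1.2): in the velocity ball of
radius `V`, `vol(shortBad) ≤ N⁴ · (d r vol B₁)² · vol(B̄_V)^N` — contact and grazing are null,
two thin shells cost `r²` (`0 < ε`, `0 ≤ r`, `ε + r < 1/2`). [cite: GST2013, Lemma 4.1.2] -/
theorem volume_shortBad_inter_velBall_le (hε : 0 < ε) (hr : 0 ≤ r) (h : ε + r < 1 / 2) (V : ℝ) :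
    volume (shortBad N ε r ∩ velBall N d (UnitAddTorus d) V) ≤
      (N : ℝ≥0∞) ^ 4 * ((ENNReal.ofReal (Fintype.card d * r) *
        volume (Metric.ball (0 : EuclideanSpace ℝ d) 1)) ^ 2 *
          volume (Metric.closedBall (0 : EuclideanSpace ℝ d) V) ^ N) := by
  set B := (ENNReal.ofReal (Fintype.card d * r) *
        volume (Metric.ball (0 : EuclideanSpace ℝ d) 1)) ^ 2 *
          volume (Metric.closedBall (0 : EuclideanSpace ℝ d) V) ^ N with hB
  -- the three parts
  have h1 : volume (⋃ p : Fin N × Fin N, {z : Config N d (UnitAddTorus d) | p.1 ≠ p.2 ∧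
      z ∈ contactSet (Torus.geometry d) N ε p.1 p.2}) = 0 := by
    refine measure_iUnion_null fun p => ?_
    by_cases hp : p.1 = p.2
    · convert measure_empty (μ := (volume : Measure (Config N d (UnitAddTorus d))))
      ext z; simp [hp]
    · have : {z : Config N d (UnitAddTorus d) | p.1 ≠ p.2 ∧
          z ∈ contactSet (Torus.geometry d) N ε p.1 p.2} = contactSet (Torus.geometry d) N ε p.1 p.2 := by
        ext z; simp [hp]
      rw [this]
      exact volume_contactSet hε.ne' hp
  have h3 : volume (⋃ p : Fin N × Fin N, {z : Config N d (UnitAddTorus d) | p.1 ≠ p.2 ∧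
      pairDisc ε ((Torus.geometry d).sepVec (z p.1).1 (z p.2).1) ((z p.1).2 - (z p.2).2) = 0 ∧
      (z p.1).2 ≠ (z p.2).2}) = 0 := by
    refine measure_iUnion_null fun p => ?_
    by_cases hp : p.1 = p.2
    · convert measure_empty (μ := (volume : Measure (Config N d (UnitAddTorus d))))
      ext z; simp [hp]
    · have : {z : Config N d (UnitAddTorus d) | p.1 ≠ p.2 ∧
          pairDisc ε ((Torus.geometry d).sepVec (z p.1).1 (z p.2).1) ((z p.1).2 - (z p.2).2) = 0 ∧
          (z p.1).2 ≠ (z p.2).2} = {z : Config N d (UnitAddTorus d) |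
          pairDisc ε ((Torus.geometry d).sepVec (z p.1).1 (z p.2).1) ((z p.1).2 - (z p.2).2) = 0 ∧
          (z p.1).2 ≠ (z p.2).2} := by
        ext z; simp [hp]
      rw [this]
      exact volume_setOf_pairDisc_sepVec_eq_zero hε.ne' hp
  have h2 : volume ((⋃ pq : (Fin N × Fin N) × (Fin N × Fin N), {z : Config N d (UnitAddTorus d) |
      pq.1.1 ≠ pq.1.2 ∧ pq.2.1 ≠ pq.2.2 ∧ ({pq.1.1, pq.1.2} : Finset (Fin N)) ≠ {pq.2.1, pq.2.2} ∧
      z ∈ closePair N d ε r pq.1.1 pq.1.2 ∩ closePair N d ε r pq.2.1 pq.2.2}) ∩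
        velBall N d (UnitAddTorus d) V) ≤ (N : ℝ≥0∞) ^ 4 * B := by
    rw [iUnion_inter]
    refine (measure_iUnion_fintype_le _ _).trans ?_
    have hcard : (Finset.univ : Finset ((Fin N × Fin N) × (Fin N × Fin N))).card = N ^ 4 := by
      simp [Finset.card_univ, Fintype.card_prod, Fintype.card_fin]; ring
    have hle : ∀ pq : (Fin N × Fin N) × (Fin N × Fin N), volume ({z : Config N d (UnitAddTorus d) |
        pq.1.1 ≠ pq.1.2 ∧ pq.2.1 ≠ pq.2.2 ∧ ({pq.1.1, pq.1.2} : Finset (Fin N)) ≠ {pq.2.1, pq.2.2} ∧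
        z ∈ closePair N d ε r pq.1.1 pq.1.2 ∩ closePair N d ε r pq.2.1 pq.2.2} ∩
          velBall N d (UnitAddTorus d) V) ≤ B := by
      intro pq
      by_cases hc : pq.1.1 ≠ pq.1.2 ∧ pq.2.1 ≠ pq.2.2 ∧
          ({pq.1.1, pq.1.2} : Finset (Fin N)) ≠ {pq.2.1, pq.2.2}
      · have : {z : Config N d (UnitAddTorus d) |
            pq.1.1 ≠ pq.1.2 ∧ pq.2.1 ≠ pq.2.2 ∧ ({pq.1.1, pq.1.2} : Finset (Fin N)) ≠ {pq.2.1, pq.2.2} ∧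
            z ∈ closePair N d ε r pq.1.1 pq.1.2 ∩ closePair N d ε r pq.2.1 pq.2.2} =
            closePair N d ε r pq.1.1 pq.1.2 ∩ closePair N d ε r pq.2.1 pq.2.2 := by
          ext z; simp only [mem_setOf_eq, mem_inter_iff]; tauto
        rw [this]
        exact volume_closePair_inter_closePair_le hε hr h hc.1 hc.2.1 hc.2.2 V
      · have : {z : Config N d (UnitAddTorus d) |
            pq.1.1 ≠ pq.1.2 ∧ pq.2.1 ≠ pq.2.2 ∧ ({pq.1.1, pq.1.2} : Finset (Fin N)) ≠ {pq.2.1, pq.2.2} ∧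
            z ∈ closePair N d ε r pq.1.1 pq.1.2 ∩ closePair N d ε r pq.2.1 pq.2.2} = ∅ := by
          ext z; simp only [mem_setOf_eq, mem_inter_iff, mem_empty_iff_false, iff_false]; tauto
        rw [this, empty_inter, measure_empty]
        exact bot_le
    calc ∑ pq : (Fin N × Fin N) × (Fin N × Fin N), volume ({z : Config N d (UnitAddTorus d) |
          pq.1.1 ≠ pq.1.2 ∧ pq.2.1 ≠ pq.2.2 ∧ ({pq.1.1, pq.1.2} : Finset (Fin N)) ≠ {pq.2.1, pq.2.2} ∧
          z ∈ closePair N d ε r pq.1.1 pq.1.2 ∩ closePair N d ε r pq.2.1 pq.2.2} ∩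
            velBall N d (UnitAddTorus d) V)
        ≤ ∑ _pq : (Fin N × Fin N) × (Fin N × Fin N), B := Finset.sum_le_sum fun pq _ => hle pq
      _ = (N : ℝ≥0∞) ^ 4 * B := by
          rw [Finset.sum_const, hcard, nsmul_eq_mul]; push_cast; ring
  -- assemble
  rw [shortBad, union_inter_distrib_right, union_inter_distrib_right]
  refine (measure_union_le _ _).trans ?_
  refine (add_le_add (measure_union_le _ _) le_rfl).trans ?_
  have h1' : volume ((⋃ p : Fin N × Fin N, {z : Config N d (UnitAddTorus d) | p.1 ≠ p.2 ∧
      z ∈ contactSet (Torus.geometry d) N ε p.1 p.2}) ∩ velBall N d (UnitAddTorus d) V) = 0 :=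
    measure_mono_null inter_subset_left h1
  have h3' : volume ((⋃ p : Fin N × Fin N, {z : Config N d (UnitAddTorus d) | p.1 ≠ p.2 ∧
      pairDisc ε ((Torus.geometry d).sepVec (z p.1).1 (z p.2).1) ((z p.1).2 - (z p.2).2) = 0 ∧
      (z p.1).2 ≠ (z p.2).2}) ∩ velBall N d (UnitAddTorus d) V) = 0 :=
    measure_mono_null inter_subset_left h3
  rw [h1', h3', zero_add, add_zero]
  exact h2

/-- **The complement of the short-time good set in the domain is thin**:
`vol((D \ shortGood) ∩ velBall V) ≤ N⁴ (d r vol B₁)² vol(B̄_V)^N`. [cite: GST2013, Lemma 4.1.2] -/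
theorem volume_diff_shortGood_inter_velBall_le (hε : 0 < ε) (hr : 0 ≤ r) (h : ε + r < 1 / 2)
    (δ V : ℝ) :
    volume ((hardSphereDomain (Torus.geometry d) N ε \ shortGood N ε r δ) ∩
        velBall N d (UnitAddTorus d) V) ≤
      (N : ℝ≥0∞) ^ 4 * ((ENNReal.ofReal (Fintype.card d * r) *
        volume (Metric.ball (0 : EuclideanSpace ℝ d) 1)) ^ 2 *
          volume (Metric.closedBall (0 : EuclideanSpace ℝ d) V) ^ N) := by
  refine le_trans (measure_mono ?_) (volume_shortBad_inter_velBall_le hε hr h V)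
  rintro z ⟨⟨hz, hns⟩, hv⟩
  exact ⟨mem_shortBad_of_not_mem_shortGood hz hns, hv⟩

end Bad

end Alexander

end Kinetic

end

end Literature.Analysis.FluidPDE
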